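import Literature.Topology.FourManifolds.TautFoliationsDiscAtlas
import Mathlib.Analysis.Convex.PathConnected
import Mathlib.Analysis.Normed.Module.Convex
import HarnessLib

/-!
# A convex open plane set minus finitely many points is path connected

Topic: connectedness of the carrier `X₀` of the contour foliation of a square grid (the open
big square minus the finitely many centres and vertices), needed for the V-process inside the
coned fence collar (a nonempty proper open subset of a connected space has nonempty frontier).
**A convex open subset of the plane minus a finite set is path connected**
(`isPathConnected_diff_finite`): join `x` to a nearby point `z = x + s d` by a short segment free
of punctures, in a direction `d = (1, m)` of slope `m` avoiding the finitely many slopes of the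
punctures seen from `y` and that of `y - x`; then each line through `y` and a puncture meets the
ray of `z` in at most one parameter `s`, so for all but finitely many small `s` the segment
`[z, y]` is free of punctures too. Consequently the carrier `X₀` is preconnected
(`Grid.isPreconnected_X₀`, `Grid.preconnectedSpace_X₀`).

* `cross`, `cross_eq_zero_of_mem_segment`, `isPathConnected_diff_finite`,
  `Grid.isPreconnected_X₀`, `Grid.preconnectedSpace_X₀` (**proved**).

All statements are [folklore].
-/

noncomputable section

open Set Filter Metric Topology Function

namespace Literature.Topology.FourManifolds

namespace PuncturedConvex

/-- The planar cross product. [folklore] -/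
def cross (u v : ℝ × ℝ) : ℝ := u.1 * v.2 - u.2 * v.1

/-- A point of the segment `[z, y]` is collinear with `z` and `y`: `cross (z - y) (p - y) = 0`.
[folklore] -/
theorem cross_eq_zero_of_mem_segment {z y p : ℝ × ℝ} (hp : p ∈ segment ℝ z y) : cross (z - y) (p - y) = 0 := by
  obtain ⟨a, b, ha, hb, hab, rfl⟩ := hp
  have hb' : b = 1 - a := by linarith
  subst hb'
  simp only [cross, Prod.fst_add, Prod.snd_add, Prod.smul_fst, Prod.smul_snd, smul_eq_mul, Prod.fst_sub, Prod.snd_sub]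
  ring

/-- **A convex open plane set minus finitely many points is path connected** (when nonempty).
[folklore] -/
theorem isPathConnected_diff_finite {U : Set (ℝ × ℝ)} (hU : Convex ℝ U) (hUo : IsOpen U) {S : Set (ℝ × ℝ)} (hS : S.Finite)
    (hne : (U \ S).Nonempty) : IsPathConnected (U \ S) := by
  classical
  refine ⟨hne.some, hne.some_mem, ?_⟩
  suffices H : ∀ x ∈ U \ S, ∀ y ∈ U \ S, JoinedIn (U \ S) x y from fun y hy ↦ H _ hne.some_mem _ hy
  intro x hx y hy
  obtain ⟨hxU, hxS⟩ := hx
  obtain ⟨hyU, hyS⟩ := hy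
  -- 1. a puncture-free ball around `x` inside `U`
  obtain ⟨ρ₁, hρ₁, hρ₁U⟩ := Metric.isOpen_iff.1 hUo x hxU
  have hSc : IsClosed S := hS.isClosed
  obtain ⟨ρ₂, hρ₂, hρ₂S⟩ : ∃ ρ > (0 : ℝ), ball x ρ ⊆ Sᶜ := Metric.isOpen_iff.1 hSc.isOpen_compl x hxS
  set ρ := min ρ₁ ρ₂ with hρ
  have hρpos : 0 < ρ := lt_min hρ₁ hρ₂
  have hballU : ball x ρ ⊆ U := (ball_subset_ball (min_le_left _ _)).trans hρ₁U
  have hballS : ball x ρ ⊆ Sᶜ := (ball_subset_ball (min_le_right _ _)).trans hρ₂S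
  -- 2. a direction `d = (1, m)` of slope avoiding finitely many values
  set slope : ℝ × ℝ → ℝ := fun v ↦ v.2 / v.1 with hslope
  have hfin : ((fun p : ℝ × ℝ ↦ slope (p - y)) '' S ∪ {slope (y - x)}).Finite := (hS.image _).union (finite_singleton _)
  obtain ⟨m, hm⟩ := hfin.infinite_compl.nonempty
  have hm' : ∀ p ∈ S, slope (p - y) ≠ m := fun p hp h ↦ hm (Or.inl ⟨p, hp, h⟩)
  have hmxy : slope (y - x) ≠ m := fun h ↦ hm (Or.inr h.symm)
  set d : ℝ × ℝ := (1, m) with hd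
  -- non-parallelism: `cross d v ≠ 0` when `slope v ≠ m` or `v.1 = 0 ≠ v.2`; we use the contrapositive form
  have hcross : ∀ v : ℝ × ℝ, v ≠ 0 → slope v ≠ m → cross d v ≠ 0 := by
    intro v hv hsv h
    simp only [cross, hd, one_mul] at h
    -- `v.2 = m * v.1`
    have h2 : v.2 = m * v.1 := by linarith
    by_cases h1 : v.1 = 0
    · have : v.2 = 0 := by rw [h2, h1, mul_zero]
      exact hv (Prod.ext h1 this)
    · exact hsv (by simp only [hslope]; rw [h2]; field_simp)
  -- 3. the bad parameters: for each puncture `p`, the unique `s` with `x + s d` on the line `(y, p)`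
  set sOf : ℝ × ℝ → ℝ := fun p ↦ -(cross (x - y) (p - y)) / cross d (p - y) with hsOf
  have hbadfin : (sOf '' S).Finite := hS.image _
  have hIinf : (Ioo 0 (ρ / (1 + |m|))).Infinite := Ioo_infinite (div_pos hρpos (by positivity))
  obtain ⟨s, hsI, hsbad⟩ := (hIinf.sdiff hbadfin).nonempty
  set z : ℝ × ℝ := x + s • d with hz
  -- `z` is in the small ball
  have hnd : ‖d‖ ≤ 1 + |m| := by
    rw [hd, Prod.norm_def, Real.norm_eq_abs, Real.norm_eq_abs, abs_one]
    exact max_le (by linarith [abs_nonneg m]) (by linarith)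
  have hzball : z ∈ ball x ρ := by
    rw [mem_ball, hz, dist_eq_norm, add_sub_cancel_left, norm_smul, Real.norm_eq_abs, abs_of_pos hsI.1]
    calc s * ‖d‖ ≤ s * (1 + |m|) := mul_le_mul_of_nonneg_left hnd hsI.1.le
      _ < ρ / (1 + |m|) * (1 + |m|) := mul_lt_mul_of_pos_right hsI.2 (by positivity)
      _ = ρ := div_mul_cancel₀ _ (by positivity)
  have hzU : z ∈ U := hballU hzball
  have hzS : z ∉ S := fun h ↦ hballS hzball h
  -- 4. the segment `[x, z]` lies in the ball, off `S`
  have hseg₁ : segment ℝ x z ⊆ U \ S := fun p hp ↦ by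
    have hpb : p ∈ ball x ρ := (convex_ball x ρ).segment_subset (mem_ball_self hρpos) hzball hp
    exact ⟨hballU hpb, fun h ↦ hballS hpb h⟩
  -- 5. the segment `[z, y]` lies in `U`, off `S`
  have hseg₂ : segment ℝ z y ⊆ U \ S := fun p hp ↦ by
    refine ⟨hU.segment_subset hzU hyU hp, fun hpS ↦ ?_⟩
    -- collinearity gives the bad parameter
    have hcol := cross_eq_zero_of_mem_segment hp
    have hpy : p - y ≠ 0 := fun h ↦ hyS (by rw [sub_eq_zero] at h; rw [← h]; exact hpS)
    have hcr : cross d (p - y) ≠ 0 := hcross _ hpy (hm' p hpS)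
    have hexp : cross (z - y) (p - y) = cross (x - y) (p - y) + s * cross d (p - y) := by
      simp only [cross, hz, hd, Prod.fst_add, Prod.snd_add, Prod.fst_sub, Prod.snd_sub, Prod.smul_fst, Prod.smul_snd, smul_eq_mul]
      ring
    rw [hexp] at hcol
    have hs : s = sOf p := by
      simp only [hsOf]
      field_simp
      linarith
    exact hsbad ⟨p, hpS, hs.symm⟩
  exact (JoinedIn.of_segment_subset hseg₁).trans (JoinedIn.of_segment_subset hseg₂)

end PuncturedConvex

namespace SquareGrid.Grid

open PuncturedConvex

variable (g : Grid)

/-- **The carrier `X₀` of the contour foliation is preconnected** (the open big square minus the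
finitely many centres and vertices). [folklore] -/
theorem isPreconnected_X₀ : IsPreconnected (g.X₀ : Set (ℝ × ℝ)) := by
  have heq : (g.X₀ : Set (ℝ × ℝ)) = ball g.bigCentre (g.n * g.ℓ) \ (g.centres ∪ g.vertices) := by
    ext x; rw [SetLike.mem_coe, g.mem_X₀_iff, Set.mem_sdiff, mem_union, not_or]
  rw [heq]
  by_cases hne : (ball g.bigCentre (g.n * g.ℓ) \ (g.centres ∪ g.vertices)).Nonempty
  · exact (isPathConnected_diff_finite (convex_ball _ _) isOpen_ball (g.finite_centres.union g.finite_vertices) hne).isConnected.isPreconnected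
  · rw [not_nonempty_iff_eq_empty.1 hne]; exact isPreconnected_empty

/-- The carrier is a preconnected space. [folklore] -/
theorem preconnectedSpace_X₀ : PreconnectedSpace g.X₀ :=
  isPreconnected_iff_preconnectedSpace.1 g.isPreconnected_X₀

end SquareGrid.Grid

end Literature.Topology.FourManifolds
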